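import Mathlib

/-!
# Route BarrierLever — item 20195 `ChowHitsThinRowPartitionMinors` is FALSE, III: the finite-sum
# identities behind the row-dependence certificate

Helper file (`--supports stmt-ValiantsHypothesis-20195`; cell valiant-natproofs, rung V4, 𝒟-side;
seat val-np-p2 gen 9).  Closes NO item; definition-free; imports only Mathlib.  Part of the kernel
REFUTATION of items 20195 / 20172 / 20239 (memo HOME/val-np-p2/g9/REFUTATION-20195-valnp2-g9.md, §2):
pure finite-sum algebra over `ℂ` for a symmetric zero-diagonal matrix `N`, a coefficient matrix `A`
and `ν k k' = Σ_{a,b} A k a · N a b · A k' b`: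

* `sum_nu_mul_mul` — `Σ_{k,k'} ν k k' · P k · Q k' = Σ_{a,b} N a b (Σ_k A k a P k)(Σ_k A k b Q k)`;
* `sum_N_mul_eq_zero_right/left` — contractions with `N` vanish when `N · M = 0`;
* `certificate_algebra` — the identity
  `½(Σν)·W + Σ_a λ_a (Σ_k A k a · Y k) + Σ_{a≠b} ½ N a b (Σ_{k≠k'} A k a A k' b X k k')
   = Σ_{k,k'} ½ ν k k' (X k k' - Y k - Y k' + W)` with `λ_a = -Σ_b N a b Σ_j A j b`, valid when
  `ν k k = 0` for all `k` (the isotropy condition of the certificate).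

WHAT THIS IS NOT: bookkeeping; nothing on item 19717, on crux stmt-ValiantsHypothesis-14610, or on
`VP` versus `VNP`.
-/

set_option linter.dupNamespace false

namespace Summit.ValiantsHypothesis.ValiantsHypothesis.Theorems.BarrierLever.ChowStarve

open Finset

variable {h : ℕ}

/-! ## 4. A quadratic-form swap -/

/-- `Σ_{k,k'} (Σ_{a,b} A k a · N a b · A k' b) · P k · Q k' = Σ_{a,b} N a b · (Σ_k A k a · P k) · (Σ_k A k b · Q k)`. -/
theorem sum_nu_mul_mul (A : Fin (h + h) → Fin h → ℂ) (N : Fin h → Fin h → ℂ) (P Q : Fin (h + h) → ℂ) :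
    ∑ k, ∑ k', (∑ a, ∑ b, A k a * N a b * A k' b) * P k * Q k' =
      ∑ a, ∑ b, N a b * (∑ k, A k a * P k) * (∑ k, A k b * Q k) := by
  have eL : ∀ k k', (∑ a, ∑ b, A k a * N a b * A k' b) * P k * Q k' =
      ∑ a, ∑ b, A k a * N a b * A k' b * P k * Q k' := by
    intro k k'
    rw [Finset.sum_mul, Finset.sum_mul]
    refine Finset.sum_congr rfl fun a _ => ?_
    rw [Finset.sum_mul, Finset.sum_mul]
  have eR : ∀ a b, N a b * (∑ k, A k a * P k) * (∑ k, A k b * Q k) =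
      ∑ k, ∑ k', A k a * N a b * A k' b * P k * Q k' := by
    intro a b
    simp_rw [Finset.mul_sum, Finset.sum_mul]
    rw [Finset.sum_comm]
    exact Finset.sum_congr rfl fun k _ => Finset.sum_congr rfl fun k' _ => by ring
  simp_rw [eL, eR]
  calc ∑ k, ∑ k', ∑ a, ∑ b, A k a * N a b * A k' b * P k * Q k'
      = ∑ k, ∑ a, ∑ k', ∑ b, A k a * N a b * A k' b * P k * Q k' :=
        Finset.sum_congr rfl fun k _ => Finset.sum_comm
    _ = ∑ a, ∑ k, ∑ k', ∑ b, A k a * N a b * A k' b * P k * Q k' := Finset.sum_comm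
    _ = ∑ a, ∑ k, ∑ b, ∑ k', A k a * N a b * A k' b * P k * Q k' :=
        Finset.sum_congr rfl fun a _ => Finset.sum_congr rfl fun k _ => Finset.sum_comm
    _ = ∑ a, ∑ b, ∑ k, ∑ k', A k a * N a b * A k' b * P k * Q k' :=
        Finset.sum_congr rfl fun a _ => Finset.sum_comm

/-- Contractions with `N` that vanish termwise: `Σ_{a,b} N a b · S a · M b = 0` if `N · M = 0`. -/
theorem sum_N_mul_eq_zero_right (N : Fin h → Fin h → ℂ) (S M : Fin h → ℂ)
    (hM : ∀ a, ∑ b, N a b * M b = 0) : ∑ a, ∑ b, N a b * S a * M b = 0 := by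
  refine Finset.sum_eq_zero fun a _ => ?_
  have e : ∑ b, N a b * S a * M b = S a * ∑ b, N a b * M b := by
    rw [Finset.mul_sum]
    exact Finset.sum_congr rfl fun b _ => by ring
  rw [e, hM a, mul_zero]

/-- `Σ_{a,b} N a b · M a · S b = 0` if `N` is symmetric and `N · M = 0`. -/
theorem sum_N_mul_eq_zero_left (N : Fin h → Fin h → ℂ) (hNsym : ∀ a b, N a b = N b a)
    (S M : Fin h → ℂ) (hM : ∀ a, ∑ b, N a b * M b = 0) : ∑ a, ∑ b, N a b * M a * S b = 0 := by
  rw [Finset.sum_comm]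
  refine Finset.sum_eq_zero fun b _ => ?_
  have e : ∑ a, N a b * M a * S b = S b * ∑ a, N b a * M a := by
    rw [Finset.mul_sum]
    exact Finset.sum_congr rfl fun a _ => by rw [hNsym a b]; ring
  rw [e, hM b, mul_zero]

/-! ## 7. The finite-sum identity behind the certificate -/

/-- **The finite-sum identity** `λ_∅ W + Σ_a λ_a (Σ_k A k a Y_k) + Σ_{a≠b} ½N_ab (Σ_{k≠k'} A A X)
 = Σ_{k,k'} ½ν (X_{kk'} - Y_k - Y_{k'} + W)` (any symmetric zero-diagonal `N` with `ν_kk = 0`). -/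
theorem certificate_algebra {ι κ : Type*} [Fintype ι] [DecidableEq ι] [Fintype κ] [DecidableEq κ]
    (A : ι → κ → ℂ) (N : κ → κ → ℂ) (hNsym : ∀ a b, N a b = N b a) (hNdiag : ∀ a, N a a = 0)
    (hNiso : ∀ k, ∑ a, ∑ b, A k a * N a b * A k b = 0) (W : ℂ) (Y : ι → ℂ) (X : ι → ι → ℂ) :
    (∑ k, ∑ k', (∑ a, ∑ b, A k a * N a b * A k' b)) / 2 * W +
      ∑ a, (-(∑ b, N a b * ∑ j, A j b)) * (∑ k, A k a * Y k) +
      ∑ a, ∑ b ∈ univ.erase a, N a b / 2 * (∑ k, ∑ k' ∈ univ.erase k, A k a * A k' b * X k k') =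
    ∑ k, ∑ k', (∑ a, ∑ b, A k a * N a b * A k' b) / 2 * (X k k' - Y k - Y k' + W) := by
  -- (I1) the singleton part
  have hI1 : ∑ a, (-(∑ b, N a b * ∑ j, A j b)) * (∑ k, A k a * Y k) =
      ∑ k, (-(∑ k', ∑ a, ∑ b, A k a * N a b * A k' b)) * Y k := by
    have eL : ∑ a, (-(∑ b, N a b * ∑ j, A j b)) * (∑ k, A k a * Y k) =
        -(∑ a, ∑ b, ∑ j, ∑ k, N a b * A j b * A k a * Y k) := by
      rw [← Finset.sum_neg_distrib]
      refine Finset.sum_congr rfl fun a _ => ?_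
      rw [neg_mul, Finset.sum_mul, neg_inj]
      refine Finset.sum_congr rfl fun b _ => ?_
      simp_rw [Finset.mul_sum, Finset.sum_mul]
      rw [Finset.sum_comm]
      exact Finset.sum_congr rfl fun j _ => Finset.sum_congr rfl fun k _ => by ring
    have eR : ∑ k, (-(∑ k', ∑ a, ∑ b, A k a * N a b * A k' b)) * Y k =
        -(∑ a, ∑ b, ∑ j, ∑ k, N a b * A j b * A k a * Y k) := by
      rw [← Finset.sum_neg_distrib]
      calc ∑ k, (-(∑ k', ∑ a, ∑ b, A k a * N a b * A k' b)) * Y k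
          = ∑ k, ∑ k', ∑ a, ∑ b, -(N a b * A k' b * A k a * Y k) := by
            refine Finset.sum_congr rfl fun k _ => ?_
            rw [neg_mul, Finset.sum_mul, ← Finset.sum_neg_distrib]
            refine Finset.sum_congr rfl fun k' _ => ?_
            rw [Finset.sum_mul, ← Finset.sum_neg_distrib]
            refine Finset.sum_congr rfl fun a _ => ?_
            rw [Finset.sum_mul, ← Finset.sum_neg_distrib]
            exact Finset.sum_congr rfl fun b _ => by ring
        _ = ∑ a, ∑ k, ∑ k', ∑ b, -(N a b * A k' b * A k a * Y k) :=
            (Finset.sum_congr rfl fun k _ => Finset.sum_comm).trans Finset.sum_comm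
        _ = ∑ a, ∑ b, ∑ k, ∑ k', -(N a b * A k' b * A k a * Y k) :=
            Finset.sum_congr rfl fun a _ =>
              (Finset.sum_congr rfl fun k _ => Finset.sum_comm).trans Finset.sum_comm
        _ = ∑ a, ∑ b, ∑ j, ∑ k, -(N a b * A j b * A k a * Y k) := by
            refine Finset.sum_congr rfl fun a _ => Finset.sum_congr rfl fun b _ => ?_
            exact Finset.sum_comm
        _ = ∑ a, -(∑ b, ∑ j, ∑ k, N a b * A j b * A k a * Y k) := by
            simp only [Finset.sum_neg_distrib]
    rw [eL, eR]
  -- (I2) the pair part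
  have hI2 : ∑ a, ∑ b ∈ univ.erase a, N a b / 2 * (∑ k, ∑ k' ∈ univ.erase k, A k a * A k' b * X k k') =
      ∑ k, ∑ k', (∑ a, ∑ b, A k a * N a b * A k' b) / 2 * X k k' := by
    have ea : ∀ a, ∑ b ∈ univ.erase a, N a b / 2 * (∑ k, ∑ k' ∈ univ.erase k, A k a * A k' b * X k k') =
        ∑ b, N a b / 2 * (∑ k, ∑ k' ∈ univ.erase k, A k a * A k' b * X k k') := by
      intro a
      rw [Finset.sum_erase_eq_sub (Finset.mem_univ a), hNdiag a, zero_div, zero_mul, sub_zero]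
    simp_rw [ea]
    have ek : ∀ a b, ∑ k, ∑ k' ∈ univ.erase k, A k a * A k' b * X k k' =
        ∑ k, ∑ k', A k a * A k' b * X k k' - ∑ k, A k a * A k b * X k k := by
      intro a b
      rw [← Finset.sum_sub_distrib]
      exact Finset.sum_congr rfl fun k _ => Finset.sum_erase_eq_sub (Finset.mem_univ k)
    simp_rw [ek, mul_sub, Finset.sum_sub_distrib]
    have ediag : ∑ a, ∑ b, N a b / 2 * ∑ k, A k a * A k b * X k k = 0 := by
      have e1 : ∑ a, ∑ b, N a b / 2 * ∑ k, A k a * A k b * X k k =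
          ∑ k, (∑ a, ∑ b, A k a * N a b * A k b) / 2 * X k k := by
        calc ∑ a, ∑ b, N a b / 2 * ∑ k, A k a * A k b * X k k
            = ∑ a, ∑ b, ∑ k, A k a * N a b * A k b / 2 * X k k := by
              refine Finset.sum_congr rfl fun a _ => Finset.sum_congr rfl fun b _ => ?_
              rw [Finset.mul_sum]
              exact Finset.sum_congr rfl fun k _ => by ring
          _ = ∑ k, ∑ a, ∑ b, A k a * N a b * A k b / 2 * X k k :=
              (Finset.sum_congr rfl fun a _ => Finset.sum_comm).trans Finset.sum_comm
          _ = ∑ k, (∑ a, ∑ b, A k a * N a b * A k b) / 2 * X k k := by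
              refine Finset.sum_congr rfl fun k _ => ?_
              rw [Finset.sum_div, Finset.sum_mul]
              refine Finset.sum_congr rfl fun a _ => ?_
              rw [Finset.sum_div, Finset.sum_mul]
      rw [e1]
      exact Finset.sum_eq_zero fun k _ => by rw [hNiso k, zero_div, zero_mul]
    rw [ediag, sub_zero]
    calc ∑ a, ∑ b, N a b / 2 * ∑ k, ∑ k', A k a * A k' b * X k k'
        = ∑ a, ∑ b, ∑ k, ∑ k', A k a * N a b * A k' b / 2 * X k k' := by
          refine Finset.sum_congr rfl fun a _ => Finset.sum_congr rfl fun b _ => ?_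
          rw [Finset.mul_sum]
          refine Finset.sum_congr rfl fun k _ => ?_
          rw [Finset.mul_sum]
          exact Finset.sum_congr rfl fun k' _ => by ring
      _ = ∑ a, ∑ k, ∑ b, ∑ k', A k a * N a b * A k' b / 2 * X k k' :=
          Finset.sum_congr rfl fun a _ => Finset.sum_comm
      _ = ∑ k, ∑ a, ∑ b, ∑ k', A k a * N a b * A k' b / 2 * X k k' := Finset.sum_comm
      _ = ∑ k, ∑ a, ∑ k', ∑ b, A k a * N a b * A k' b / 2 * X k k' :=
          Finset.sum_congr rfl fun k _ => Finset.sum_congr rfl fun a _ => Finset.sum_comm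
      _ = ∑ k, ∑ k', ∑ a, ∑ b, A k a * N a b * A k' b / 2 * X k k' :=
          Finset.sum_congr rfl fun k _ => Finset.sum_comm
      _ = ∑ k, ∑ k', (∑ a, ∑ b, A k a * N a b * A k' b) / 2 * X k k' := by
          refine Finset.sum_congr rfl fun k _ => Finset.sum_congr rfl fun k' _ => ?_
          rw [Finset.sum_div, Finset.sum_mul]
          refine Finset.sum_congr rfl fun a _ => ?_
          rw [Finset.sum_div, Finset.sum_mul]
  rw [hI1, hI2]
  -- (I3) symmetry of `ν` and bookkeeping
  have hνs : ∀ k k', (∑ a, ∑ b, A k a * N a b * A k' b) = ∑ a, ∑ b, A k' a * N a b * A k b := by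
    intro k k'
    rw [Finset.sum_comm]
    exact Finset.sum_congr rfl fun b _ => Finset.sum_congr rfl fun a _ => by rw [hNsym a b]; ring
  have hY : ∑ k, ∑ k', (∑ a, ∑ b, A k a * N a b * A k' b) / 2 * Y k' =
      ∑ k, ∑ k', (∑ a, ∑ b, A k a * N a b * A k' b) / 2 * Y k := by
    rw [Finset.sum_comm]
    exact Finset.sum_congr rfl fun k _ => Finset.sum_congr rfl fun k' _ => by rw [hνs]
  have hsplit : ∑ k, ∑ k', (∑ a, ∑ b, A k a * N a b * A k' b) / 2 * (X k k' - Y k - Y k' + W) =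
      ∑ k, ∑ k', (∑ a, ∑ b, A k a * N a b * A k' b) / 2 * X k k' -
        ∑ k, ∑ k', (∑ a, ∑ b, A k a * N a b * A k' b) / 2 * Y k -
        ∑ k, ∑ k', (∑ a, ∑ b, A k a * N a b * A k' b) / 2 * Y k' +
        ∑ k, ∑ k', (∑ a, ∑ b, A k a * N a b * A k' b) / 2 * W := by
    simp only [mul_add, mul_sub, Finset.sum_add_distrib, Finset.sum_sub_distrib]
  rw [hsplit, hY]
  have hW : (∑ k, ∑ k', (∑ a, ∑ b, A k a * N a b * A k' b)) / 2 * W =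
      ∑ k, ∑ k', (∑ a, ∑ b, A k a * N a b * A k' b) / 2 * W := by
    rw [Finset.sum_div, Finset.sum_mul]
    exact Finset.sum_congr rfl fun k _ => by rw [Finset.sum_div, Finset.sum_mul]
  have hYY : ∑ k, (-(∑ k', ∑ a, ∑ b, A k a * N a b * A k' b)) * Y k =
      -(∑ k, ∑ k', (∑ a, ∑ b, A k a * N a b * A k' b) / 2 * Y k) -
        ∑ k, ∑ k', (∑ a, ∑ b, A k a * N a b * A k' b) / 2 * Y k := by
    rw [← Finset.sum_neg_distrib, ← Finset.sum_sub_distrib]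
    refine Finset.sum_congr rfl fun k _ => ?_
    rw [neg_mul, Finset.sum_mul, ← Finset.sum_neg_distrib, ← Finset.sum_neg_distrib,
      ← Finset.sum_sub_distrib]
    exact Finset.sum_congr rfl fun k' _ => by ring
  rw [hW, hYY]
  ring

end Summit.ValiantsHypothesis.ValiantsHypothesis.Theorems.BarrierLever.ChowStarve
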